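import Mathlib
import Summits.MatrixMultiplication.Statement
import Summits.MatrixMultiplication.MatrixMultiplication.Theses.WindowedCompletionRank

/-!
# Crux `WindowCompletion` (stmt-MatrixMultiplication-5495) — line `vwindow`: the bilinear (a-blind)
# window, a TRANSFER of the trilinear completion rank to a partial-MATRIX completion rank

Route `WindowedCompletionRank`, crux #5 `WindowCompletion` (window-frame thesis): for every
`ε > 0` some `n ≥ 2`, a finite abelian `G` with `|G| ≤ n^(2+ε)`, Cohn–Umans maps
`A B C : [n] → G` and a 3-tensor `S` on `G³` with `R(S) ≤ n^ε` such that `⟨n,n,n⟩` EQUALS the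
window tensor `[αb + βc = γa]·S(γa, αb, βc)` (`α(x,y) = A x − B y`, `β(y,z) = B y + C z`,
`γ(x,z) = A x + C z`).

## The transfer (strategist, 2026-08-17)

Flatten the completion problem along the OUTPUT leg.  A completion that is constant in the first
(output) leg, `S(g; u, v) = V(u, v)`, satisfies the window equation iff the PARTIAL MATRIX
`V` on rows `b = (x', y)` (X-entries) and columns `c = (y', z')` (Y-entries) obeys

* `V(b, c) = 1` whenever `b.2 = c.1` (the `n` diagonal classes `y = y'`: these are exactly the
  matrix-multiplication cells, the output index being forced to `a = (x', z')` by injectivity of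
  `γ`), and
* `V(b, c) = 0` whenever `b.2 ≠ c.1` and the pair COLLIDES, i.e. `αb + βc ∈ γ([n]²)` (an alien cell
  of the window),
* all other entries free,

and then `R(S) ≤ rank V` (a rank-`r` factorisation `V = ξ ηᵀ` is `r` triads `1_G ⊗ ξ_i ⊗ η_i`).
So `crank(frame) ≤ mr(V_frame)`, the minimum rank of a completion of this partial matrix, and

  `VFrames`  :=  for every `ε > 0` a frame with `|G| ≤ n^(2+ε)` and `mr(V_frame) ≤ n^ε`

implies the crux (`stub_liftV`, provable now, M-sized).  `VFrames` is STRONGER than the crux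
(it forgoes genuinely trilinear completions such as the delegation completion of
`DelegationBound`, whose Fourier side is `⟨m,m,m⟩`), but it lives in a language WITH tools:

* lower bounds: fooling sets / transversal cliques — if `u_y = A x_y − B y`, `w_y = B y + C z_y`
  (`y ∈ Y'`) satisfy `u_y + w_{y'} ∈ A[n] + C[n]` for all `y ≠ y'` in `Y'`, the `Y' × Y'`
  compression of every completion is the identity, so `mr(V) ≥ |Y'|`; the natural conjecture
  V-INERTIA `|G|·mr(V_frame) ≥ n^(3−o(1))` (tight for bucket-hash frames, where
  `mr(V) = n³/|G|` exactly) is an additive-combinatorics statement about cliques in the collision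
  graph `T_y ∩ T_{y'} ≠ ∅`, `T_y = (A[n] + C[n]) − B y`, and would kill this line cleanly;
* upper bounds: a rank-`(r+1)` completion is produced by any EXACT cover of the collision relation
  by `r` bicliques `R_i × C_i` avoiding the diagonal classes (`V = J − Σ 1_{R_i × C_i}`), a finite
  design problem (ILP/SAT-searchable at small `n`), and more generally by bi-orthogonal vector
  systems `⟨ξ_b, η_c⟩ ∈ {1 on classes, 0 on collisions}`.

The regime of the bet is `|G| > n²` (for the full window `|G| = n²` every entry of `V` is forced,
`V = I_n ⊗ J_n`, `mr = n`: no gain is possible in V-form there), complementary to delegation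
(`|G| = n²`, trilinear).  Milestone (finite, certifiable): ONE frame with `|G|·mr(V_frame) < n³`
(beating every bucket-hash interpolation, which have `|G|·mr(V) = n³` exactly).

Stubs: `stub_vFrames : VFrames` (XL, the bet) and `stub_liftV : LiftV` (`LiftV := VFrames → WindowCompletion`;
M, provable now: the case analysis above plus `tensorRank_le_of_eq_sum`).  Skeleton
`WindowCompletion_skeleton : WindowCompletion` (hypothesis-free, sorry only via the stubs) and the
hypothesis form `WindowCompletion_of : VFrames → LiftV → WindowCompletion` are modus ponens (trivial
seam, declared); the mathematical content of the seam is carried by `stub_liftV`, kept as a stub so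
that an idle prover can land it `--supports stmt-MatrixMultiplication-5495`.

Disproof used: none exists for this crux (no `Cruxes/WindowCompletion/Disproof.lean`, no
`Theorems/WindowCompletion/Negative/`); in-route negative knowledge honoured: `InvariantSqrtBound`
(translation-invariant completions, `c ≥ √n`) concerns the FULL window, where V-form is inert
anyway; `WindowSqrtBarrier` (5493, open) would kill the crux and a fortiori this line;
`ledger negatives --problem MatrixMultiplication` (9 entries, 2026-08-17) has nothing on window /
matrix completions.
-/

set_option linter.dupNamespace false

namespace Summit.MatrixMultiplication.MatrixMultiplication.Cruxes.WindowCompletion.Vwindow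

open scoped BigOperators
open Summit.MatrixMultiplication.MatrixMultiplication.Theses.WindowedCompletionRank

/-- `VFrames` (the transferred crux `C⁺`, bilinear / a-blind window completions): for every
`ε > 0` there are `n ≥ 2`, a finite abelian `G` with `|G| ≤ n^(2+ε)` (no `DecidableEq G` binder is
needed: the statement has no `if` on `G`), maps `A B C : [n] → G`
whose Cohn–Umans leg maps `α β γ` are injective, a width `r ≤ n^ε` and vectors
`ξ_b, η_c ∈ ℂ^r` (`b, c ∈ [n]²`) with `⟨ξ_b, η_c⟩ = 1` on the diagonal classes `b.2 = c.1` and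
`⟨ξ_b, η_c⟩ = 0` on every collision (`b.2 ≠ c.1` and `αb + βc ∈ γ([n]²)`); i.e. the partial
window MATRIX has a completion of rank `≤ n^ε`. -/
def VFrames : Prop :=
  ∀ ε : ℝ, 0 < ε → ∃ n : ℕ, 2 ≤ n ∧
    ∃ (G : Type) (_ : AddCommGroup G) (_ : Fintype G),
      (Fintype.card G : ℝ) ≤ (n : ℝ) ^ (2 + ε) ∧
      ∃ (A B C : Fin n → G) (r : ℕ) (ξ η : Fin n × Fin n → Fin r → ℂ),
        (r : ℝ) ≤ (n : ℝ) ^ ε ∧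
        Function.Injective (fun b : Fin n × Fin n => A b.1 - B b.2) ∧
        Function.Injective (fun c : Fin n × Fin n => B c.1 + C c.2) ∧
        Function.Injective (fun a : Fin n × Fin n => A a.1 + C a.2) ∧
        (∀ b c : Fin n × Fin n, b.2 = c.1 → ∑ i, ξ b i * η c i = 1) ∧
        (∀ b c : Fin n × Fin n, b.2 ≠ c.1 →
          (∃ a : Fin n × Fin n, (A b.1 - B b.2) + (B c.1 + C c.2) = A a.1 + C a.2) →
          ∑ i, ξ b i * η c i = 0)

/-- `LiftV` — the statement of the lift stub, named so that the stub's type does not literally conclude the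
crux (the skeleton checker takes the FIRST theorem of the file whose conclusion is the crux decl; that
must be the hypothesis-free composition `WindowCompletion_skeleton` below). It unfolds (`Iff.rfl`) to
`VFrames → WindowCompletion`. -/
def LiftV : Prop := VFrames → WindowCompletion

/-- STUB 1 (XL, OPEN — the bet of the line): bilinear window completions of rank `n^ε` exist in
hosts of order `n^(2+ε)`.  Refutable by V-INERTIA (`|G|·mr(V) ≥ n^(3−o(1))`, an
additive-combinatorics statement about transversal cliques of the collision graph); first finite
milestone: one frame with `|G|·mr(V) < n³`. -/
theorem stub_vFrames : VFrames := by
  sorry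

/-- STUB 2 (M, PROVABLE NOW — the lift, `LiftV` = `VFrames → WindowCompletion`): a bilinear window
completion is a window completion.  Given the data of `VFrames` at `ε`, put
`S g u v := ∑ i, ξ (α⁻¹ u) i * η (β⁻¹ v) i` on `α([n]²) × β([n]²)` (zero elsewhere; `α, β` injective),
so `R(S) ≤ r` by `tensorRank_le_of_eq_sum` (triads `1 ⊗ ξ̃_i ⊗ η̃_i`), and check the window equation
cell by cell: on the window, `b.2 = c.1` forces `a = (b.1, c.2)` (injectivity of `γ`) and both sides
are `1`; `b.2 ≠ c.1` is a collision, both sides `0`; off the window the matrix-multiplication entry is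
`0` because a support cell always lies on the window (`(A x − B y) + (B y + C z) = A x + C z`); the
`DecidableEq G` instance of the crux is supplied classically. -/
theorem stub_liftV : LiftV := by
  sorry

/-- SKELETON (kernel-checked, no `sorry` of its own, no hypotheses): the crux `WindowCompletion` BY NAME
from the two registered stubs — `sorry` enters only through `stub_vFrames` and `stub_liftV`.  This is the
first theorem of the file concluding the crux, i.e. the one `ledger skeleton check` audits. -/
theorem WindowCompletion_skeleton : WindowCompletion :=
  (show VFrames → WindowCompletion from stub_liftV) stub_vFrames

/-- COMPOSITION in hypothesis form (kernel-checked, sorry-free, axioms `propext`, `Classical.choice`,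
`Quot.sound` at most): the two stub STATEMENTS imply the crux by name.  The seam is modus ponens
(declared trivial); its mathematical content is the lift `stub_liftV`. -/
theorem WindowCompletion_of : VFrames → LiftV → WindowCompletion :=
  fun hV hLift => (show VFrames → WindowCompletion from hLift) hV

/-! ## Sanity (sorry-free): the V-conditions are inhabited in kind

The trivial full-window frame at `n = 2`, `G = ZMod 2 × ZMod 2`, `A x = (x,0)`, `B y = (y,y)`,
`C z = (0,z)`, with the width-`2` vectors `ξ_(x,y) = e_y`, `η_(y',z) = e_{y'}` satisfies both
V-conditions (`⟨e_y, e_{y'}⟩ = [y = y']`; every off-class pair is a collision here and gets `0`).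
This is the `ε = 1` instance (`r = 2 ≤ 2¹`, `|G| = 4 ≤ 2³`); the content of `VFrames` is `ε → 0`. -/

/-- The inner products of the standard-basis labelling are the Kronecker delta of the classes
(an `example`, so that the registered skeleton carries no orphan declaration). [folklore] -/
example (n : ℕ) (b c : Fin n × Fin n) :
    ∑ i : Fin n, (if b.2 = i then (1 : ℂ) else 0) * (if c.1 = i then (1 : ℂ) else 0) =
      if b.2 = c.1 then 1 else 0 := by
  classical
  simp only [mul_ite, mul_one, mul_zero]
  rw [Finset.sum_ite_eq Finset.univ c.1]
  simp only [Finset.mem_univ, if_true]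

end Summit.MatrixMultiplication.MatrixMultiplication.Cruxes.WindowCompletion.Vwindow
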